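import Literature.AlgebraicGeometry.Milne1999.SpecialLefschetzGroupInvariantsSingleGenerator
import Literature.AlgebraicGeometry.Deligne1982.HodgeGroupCommutantSpan
import Mathlib.LinearAlgebra.BilinearForm.Properties
import HarnessLib

/-!
# Milne 1999, §1: the Rosati involution `β ↦ β†` of `End(H¹)` preserves `End⁰(A) ⊗ ℂ` and `C(A) ⊗ ℂ` — and Theorem 3.2 / Corollary 4.5 for one diagonalisable generator, with no polarization datum

Family `hodge`, layer `Literature/AlgebraicGeometry/Milne1999`, namespace
`Literature.AlgebraicGeometry.Milne1999` (D-0022). THEOREMS ONLY (no definition, no named fact; D-0026).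
Written for the cell `pub-hodgecm2` (COR-CM), seat `lit-milne`, binder table `HOME/lit/milne.md` rows
M2/M4, as the sequel of `Milne1999/SpecialLefschetzGroupInvariantsSingleGenerator` that DISCHARGES its
datum `J'` (the `Q_h`-adjoint of `φ^*`, there assumed to be an operator commuting with `C(A) ⊗ ℂ`).

[Milne1999LefschetzClasses] §1, p. 642: «When `D` is ample, `e_D` is nondegenerate, and we let `β†` denote
the adjoint with respect to `e_D` of a `k`-linear endomorphism `β` of `V(A)`: `e_D(βx, y) = e_D(x, β†y)`,
all `x, y ∈ V(A)`. Then `β ↦ β†` is an involution of the `k`-algebra `End_k(V(A))` whose restriction to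
`End⁰(A)` is the Rosati involution defined by `D`.» and p. 643: «Then `C(A)` is a `k`-algebra stable
under the involution `†` defined by an ample divisor `D`, and the restriction of `†` to `C(A)` is
independent of the choice of `D`.»  On the tree's carriers — `H¹(A(ℂ); ℂ)` with the pull-backs `φ^*`
(`VanGeemen1994.pullbackOne`), Milne's `C(A) ⊗ ℂ = centralizerAlgebra A` (`Milne1999/LefschetzCentraliser`)
and the polarization pairing `Q_h(x, y) = h^{dim A - 1} ⌣ x ⌣ y` (`Motives.polarizationPairingOne`, `∝` the
form dual to `e_D`) of a RATIONAL class `h` with a KÄHLER multiple `s · h`, `s > 0` (a positive rational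
multiple of the class of an ample divisor) — this file PROVES:

* **`exists_adjoint_polarizationPairingOne`** — `Q_h` is non-degenerate (hard Lefschetz, the tree's
  `eq_zero_of_forall_polarizationPairingOne_eq_zero_of_isKaehlerClass_smul'`), so every endomorphism `T` of
  `H¹(A(ℂ); ℂ)` has a `Q_h`-adjoint `T†`: `Q_h(Tx, y) = Q_h(x, T†y)`; it is unique
  (`adjoint_unique_polarizationPairingOne`), and `Q_h(x, Ty) = Q_h(T†x, y)` as well (`Q_h` is alternating).
* **`adjoint_pullbackOne_mem_span_pullbackOne`** — «the restriction of `†` to `End⁰(A)` is the Rosati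
  involution»: the adjoint of `φ^*`, `φ ∈ End(A)`, lies in the `ℂ`-span of the pull-backs `ψ^*`,
  `ψ ∈ End(A)` (the image of `End⁰(A) ⊗ ℂ`).  ROAD (not Milne's, who works with the dual abelian variety
  and Mumford §20–21): the adjoint commutes with every `Q_h`-isometry commuting with `φ^*`
  (`adjoint_comm_of_isometry`), in particular with `Hg(A)(ℂ)|_{H¹} ⊆ S(A)(ℂ)`
  (`hodgeGroupOne_le_unitaryCentralizerGroup_of_isKaehlerClass`, `Milne1999/LefschetzCentraliser`); an
  endomorphism of `H¹(A(ℂ); ℂ)` commuting with the Hodge group lies in the span of the `ψ^*` — Deligne I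
  Prop. 3.4 together with Riemann's theorem (Deligne–Milne II Thm. 6.20), both THEOREMS of the tree
  (`Deligne1982.mem_span_complexBetti_map_of_commute_hodgeGroup`, `deligneMilne1982_Thm_6_20_full_holds`).
* **`adjoint_pullbackOne_mem_centralizer_centralizerAlgebra`** — hence the adjoint of `φ^*` commutes with
  `C(A) ⊗ ℂ` (Remark 1.2: `End⁰(A) ⊗ k ⊆` the centralizer of `C(A)`), and
  **`adjoint_mem_centralizerAlgebra`** — «`C(A)` is stable under `†`».
* **`specialLefschetzGroup_invariants_le_of_generator`** — the conclusion of the cited record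
  `Milne1999_specialLefschetzGroup_invariants_le` (`Milne1999/LefschetzGroup`: Cor. 4.5 with Thm. 4.4 and
  Thm. 3.2) PROVED for every complex abelian variety `A` carrying ONE endomorphism `φ` with `φ^*`
  diagonalisable on `H¹(A(ℂ); ℂ)` and `C(A) ⊗ ℂ` the commutant of `φ^*` — with NO polarization or adjoint
  hypothesis: `specialLefschetzGroup_invariants_le_of_adjoint` of the single-generator file fed with a
  rational Kähler class (`nonempty_kaehlerRationalDatum`) and the adjoint supplied here.  With it:
  `mem_divisorClassesSpan_of_forall_exteriorPullback_eq_of_generator` (the `S(A)(ℂ)`-invariant form for a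
  given polarization class), `setOf_forall_apply_eq_self_eq_divisorClassesSpan_of_generator` (Cor. 4.5 as an
  equality of sets) and `isDivisorGenerated_of_hodgeGroup_eq_specialLefschetzGroup_of_generator`
  (Prop. 4.8 (c) ⇒ (a) on `A`).  This covers at once the loci of
  `Milne1999/SpecialLefschetzGroupInvariantsSymplectic` (`φ = 0`), `…ImaginaryQuadratic`,
  `…RealMultiplication` (whose self-adjointness hypothesis is no longer needed for the conclusion) and
  `…SingleGenerator`: simple abelian varieties of type I (`End⁰(A) = F` totally real) and of type IV with
  `d = 1` (`End⁰(A) = K` a CM field), and products of pairwise non-isogenous such, once a generator `φ`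
  of `End⁰(A)` with `φ^*` diagonalisable is given (Milne §2, pp. 645–650).
* §3: the same three statements with the hypothesis «every `ψ^*`, `ψ ∈ End(A)`, is a polynomial in
  `φ^*`» (`Algebra.adjoin`) in place of the commutant identity
  (`centralizerAlgebra_eq_centralizer_singleton_of_forall_mem_adjoin`).

NOT here: several generators (types II/III, type IV with `d ≥ 2`, isotypic powers) — the record stays
cited there; the construction of a generator from «`End⁰(A)` commutative» (primitive element) is not
done here either.

## References

* [Milne1999LefschetzClasses] J. S. Milne, Lefschetz classes on abelian varieties, Duke Math. J. 96
  (1999) 639–675: §1 pp. 642–644 (`e_D`, `β†`, the Rosati involution, `C(A)` and its `†`-stability,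
  Remark 1.2, `S(A)`), §2 pp. 645–650 (types I–IV), Thm. 3.2, Prop. 3.6, Thm. 4.4, Cor. 4.5 (p. 659),
  Prop. 4.8 (p. 660).
* [Deligne1982HodgeCycles] P. Deligne (notes by J. S. Milne), Hodge cycles on abelian varieties, LNM 900
  (1982), I §3 Prop. 3.4.
* [DeligneMilne1982Tannakian] P. Deligne, J. S. Milne, Tannakian categories, LNM 900 (1982), II
  Thm. 6.20 (Riemann).
* [MumfordAV1970] D. Mumford, Abelian Varieties (1970), §20 (the Rosati involution, p. 189) and p. 208.
* [LangeBirkenhake1992] H. Lange, Ch. Birkenhake, Complex Abelian Varieties (1992), §5.1 (Rosati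
  involution = adjoint for the Riemann form), Thm. 5.5.6.
* [VoisinHodgeI2002] C. Voisin, Hodge Theory and Complex Algebraic Geometry I (2002), Thm. 6.25,
  §7.1.2.
-/

noncomputable section

open CategoryTheory
open Literature.AlgebraicTopology.SingularHomology
open Literature.AlgebraicGeometry.HodgeTheory
open Literature.AlgebraicGeometry.Motives
open Literature.AlgebraicGeometry.VanGeemen1994 (pullbackOne hodgeClassSpan hodgeGroupOne mem_hodgeGroupOne_iff)
open Literature.Barriers.HodgeConjecture (divisorClassesSpan)

namespace Literature.AlgebraicGeometry.Milne1999

/-! ### §1 The adjoint involution `T ↦ T†` of `End(H¹(A(ℂ); ℂ))` for `Q_h` -/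

section Adjoint

variable {A : AbelianVariety ℂ} {h : complexBetti A.X 2}

/-- **Right non-degeneracy from left non-degeneracy**: `Q_h` is alternating (`Q_h(y, x) = -Q_h(x, y)`),
so if `Q_h(x, ·) = 0` forces `x = 0` then `Q_h(·, y) = 0` forces `y = 0`. [cite: Milne1999LefschetzClasses, §1 p. 642 (`e_D` skew-symmetric, nondegenerate)] -/
theorem eq_zero_of_forall_polarizationPairingOne_eq_zero_right
    (hnd : ∀ x : complexBetti A.X 1, (∀ y, polarizationPairingOne A.X h (A.dim - 1) x y = 0) → x = 0)
    (y : complexBetti A.X 1) (hy : ∀ x, polarizationPairingOne A.X h (A.dim - 1) x y = 0) : y = 0 :=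
  hnd y fun x => by rw [polarizationPairingOne_swap, hy x, neg_zero]

/-- **Existence of the adjoint** («we let `β†` denote the adjoint with respect to `e_D` of a `k`-linear
endomorphism `β` of `V(A)`: `e_D(βx, y) = e_D(x, β†y)`»): for `Q_h` non-degenerate on `H¹(A(ℂ); ℂ)`, every
endomorphism `T` has an adjoint `T†` with `Q_h(Tx, y) = Q_h(x, T†y)` (the scalar form `λ ∘ Q_h`,
`exists_bilinForm_isAlt_nondegenerate`, and Mathlib's `leftAdjointOfNondegenerate`).
[cite: Milne1999LefschetzClasses, §1 p. 642] [cite: LangeBirkenhake1992, §5.1] -/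
theorem exists_adjoint_polarizationPairingOne
    (hnd : ∀ x : complexBetti A.X 1, (∀ y, polarizationPairingOne A.X h (A.dim - 1) x y = 0) → x = 0)
    (T : Module.End ℂ (complexBetti A.X 1)) :
    ∃ T' : Module.End ℂ (complexBetti A.X 1), ∀ x y : complexBetti A.X 1,
      polarizationPairingOne A.X h (A.dim - 1) (T x) y = polarizationPairingOne A.X h (A.dim - 1) x (T' y) := by
  haveI : Module.Finite ℂ (complexBetti A.X 1) := abelianVarietyCohomologyExteriorH1_holds.finite_one A
  obtain ⟨B, hBalt, hBnd, lam, hlam, hBapp⟩ := exists_bilinForm_isAlt_nondegenerate (A := A) hnd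
  refine ⟨B.leftAdjointOfNondegenerate hBnd T, fun x y => hlam ?_⟩
  have hadj : ∀ a b, B (B.leftAdjointOfNondegenerate hBnd T a) b = B a (T b) := fun a b =>
    B.isAdjointPairLeftAdjointOfNondegenerate hBnd T a b
  rw [← hBapp, ← hBapp, ← hBalt.neg_eq y (T x), ← hadj y x, hBalt.neg_eq]

/-- **Uniqueness of the adjoint** (non-degeneracy on the right). [cite: Milne1999LefschetzClasses, §1 p. 642] -/
theorem adjoint_unique_polarizationPairingOne
    (hnd : ∀ x : complexBetti A.X 1, (∀ y, polarizationPairingOne A.X h (A.dim - 1) x y = 0) → x = 0)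
    {T T' T'' : Module.End ℂ (complexBetti A.X 1)}
    (h' : ∀ x y : complexBetti A.X 1,
      polarizationPairingOne A.X h (A.dim - 1) (T x) y = polarizationPairingOne A.X h (A.dim - 1) x (T' y))
    (h'' : ∀ x y : complexBetti A.X 1,
      polarizationPairingOne A.X h (A.dim - 1) (T x) y = polarizationPairingOne A.X h (A.dim - 1) x (T'' y)) :
    T' = T'' := by
  refine LinearMap.ext fun y => ?_
  rw [← sub_eq_zero, ← LinearMap.sub_apply]
  refine eq_zero_of_forall_polarizationPairingOne_eq_zero_right hnd _ fun x => ?_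
  rw [LinearMap.sub_apply, map_sub, ← h' x y, ← h'' x y, sub_self]

/-- **The adjoint is two-sided**: from `Q_h(Tx, y) = Q_h(x, T†y)` also `Q_h(x, Ty) = Q_h(T†x, y)` (`Q_h`
is alternating; so `†` is an involution: `T†† = T`). [cite: Milne1999LefschetzClasses, §1 p. 642 («`β ↦ β†` is an involution»)] -/
theorem polarizationPairingOne_apply_right_eq_of_adjoint {T T' : Module.End ℂ (complexBetti A.X 1)}
    (hadj : ∀ x y : complexBetti A.X 1,
      polarizationPairingOne A.X h (A.dim - 1) (T x) y = polarizationPairingOne A.X h (A.dim - 1) x (T' y))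
    (x y : complexBetti A.X 1) :
    polarizationPairingOne A.X h (A.dim - 1) x (T y) = polarizationPairingOne A.X h (A.dim - 1) (T' x) y := by
  rw [← neg_inj, ← polarizationPairingOne_swap, hadj, polarizationPairingOne_swap]

/-- **`††` is the identity**: if `T'` is the adjoint of `T`, then `T` is the adjoint of `T'`.
[cite: Milne1999LefschetzClasses, §1 p. 642 («`β ↦ β†` is an involution»)] -/
theorem adjoint_adjoint_polarizationPairingOne {T T' : Module.End ℂ (complexBetti A.X 1)}
    (hadj : ∀ x y : complexBetti A.X 1,
      polarizationPairingOne A.X h (A.dim - 1) (T x) y = polarizationPairingOne A.X h (A.dim - 1) x (T' y))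
    (x y : complexBetti A.X 1) :
    polarizationPairingOne A.X h (A.dim - 1) (T' x) y = polarizationPairingOne A.X h (A.dim - 1) x (T y) :=
  (polarizationPairingOne_apply_right_eq_of_adjoint hadj x y).symm

/-- **`†` is an anti-homomorphism**: the adjoint of `S * T` is `T† * S†`. [cite: Milne1999LefschetzClasses, §1 p. 642] -/
theorem adjoint_mul_polarizationPairingOne {S S' T T' : Module.End ℂ (complexBetti A.X 1)}
    (hS : ∀ x y : complexBetti A.X 1,
      polarizationPairingOne A.X h (A.dim - 1) (S x) y = polarizationPairingOne A.X h (A.dim - 1) x (S' y))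
    (hT : ∀ x y : complexBetti A.X 1,
      polarizationPairingOne A.X h (A.dim - 1) (T x) y = polarizationPairingOne A.X h (A.dim - 1) x (T' y))
    (x y : complexBetti A.X 1) :
    polarizationPairingOne A.X h (A.dim - 1) ((S * T) x) y =
      polarizationPairingOne A.X h (A.dim - 1) x ((T' * S') y) := by
  rw [Module.End.mul_apply, Module.End.mul_apply, hS, hT]

/-- **The adjoint of `T` commutes with every `Q_h`-isometry commuting with `T`**: if `u` preserves `Q_h`
and `u ∘ T = T ∘ u`, then `u ∘ T† = T† ∘ u` (`Q_h(z, uT†x) = Q_h(u⁻¹z, T†x) = Q_h(Tu⁻¹z, x) =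
Q_h(uTu⁻¹z, ux) = Q_h(Tz, ux) = Q_h(z, T†ux)` and non-degeneracy). Applied below to
`u ∈ S(A)(ℂ) = unitaryCentralizerGroup A h` and `T = φ^*`. [cite: Milne1999LefschetzClasses, §1 pp. 642–644] -/
theorem adjoint_comm_of_isometry
    (hnd : ∀ x : complexBetti A.X 1, (∀ y, polarizationPairingOne A.X h (A.dim - 1) x y = 0) → x = 0)
    {T T' : Module.End ℂ (complexBetti A.X 1)}
    (hadj : ∀ x y : complexBetti A.X 1,
      polarizationPairingOne A.X h (A.dim - 1) (T x) y = polarizationPairingOne A.X h (A.dim - 1) x (T' y))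
    {u : complexBetti A.X 1 ≃ₗ[ℂ] complexBetti A.X 1}
    (hu : ∀ x y : complexBetti A.X 1,
      polarizationPairingOne A.X h (A.dim - 1) (u x) (u y) = polarizationPairingOne A.X h (A.dim - 1) x y)
    (huT : ∀ x, u (T x) = T (u x)) (x : complexBetti A.X 1) : u (T' x) = T' (u x) := by
  rw [← sub_eq_zero]
  refine eq_zero_of_forall_polarizationPairingOne_eq_zero_right hnd _ fun z => ?_
  rw [map_sub, sub_eq_zero]
  obtain ⟨z', rfl⟩ : ∃ z', z = u z' := ⟨u.symm z, (u.apply_symm_apply z).symm⟩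
  rw [hu, ← hadj, ← hu, huT, hadj]

variable (hQ : IsRationalClass h) {s : ℝ} (hs : s ≠ 0) (hK : IsKaehlerClass A.dim A.X ((s : ℂ) • h))
include hQ hs hK

/-- **The adjoint of `φ^*` commutes with the Hodge group `Hg(A)(ℂ)|_{H¹}`**, for `h` a rational class
with a Kähler multiple `s · h` (`s ≠ 0`): `Hg′(A)(ℂ)|_{H¹} ≤ S(A)(ℂ)` — the Hodge group commutes with
`φ^*` and preserves `Q_h` (`hodgeGroupOne_le_unitaryCentralizerGroup_of_isKaehlerClass`, Milne p. 660
«`L(A) ⊃ Hg(A)`») — and `adjoint_comm_of_isometry`. [cite: Milne1999LefschetzClasses, §4 pp. 659–660]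
[cite: Deligne1982HodgeCycles, I §3 Prop. 3.4] -/
theorem adjoint_pullbackOne_commute_hodgeGroup (φ : A ⟶ A) {J' : Module.End ℂ (complexBetti A.X 1)}
    (hadj : ∀ x y : complexBetti A.X 1,
      polarizationPairingOne A.X h (A.dim - 1) (pullbackOne A φ x) y =
        polarizationPairingOne A.X h (A.dim - 1) x (J' y)) :
    ∀ g ∈ hodgeGroup A.dim A.X, ∀ y : complexBetti A.X 1, J' (g 1 y) = g 1 (J' y) := by
  intro g hg y
  have hnd := eq_zero_of_forall_polarizationPairingOne_eq_zero_of_isKaehlerClass_smul' hs hK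
  have hg1 : g 1 ∈ unitaryCentralizerGroup A h :=
    hodgeGroupOne_le_unitaryCentralizerGroup_of_isKaehlerClass hQ hs hK (mem_hodgeGroupOne_iff.2 ⟨g, hg, rfl⟩)
  rw [mem_unitaryCentralizerGroup_iff, mem_centralizerGroup_iff] at hg1
  exact (adjoint_comm_of_isometry hnd hadj hg1.2 (hg1.1 φ) y).symm

/-- **«The restriction of `†` to `End⁰(A)` is the Rosati involution»: the `Q_h`-adjoint of `φ^*`,
`φ ∈ End(A)`, lies in `End⁰(A) ⊗ ℂ`** — the `ℂ`-span of the pull-backs `ψ^*`, `ψ ∈ End(A)`: it commutes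
with the Hodge group (`adjoint_pullbackOne_commute_hodgeGroup`), and an endomorphism of `H¹(A(ℂ); ℂ)`
commuting with `Hg(A)(ℂ)` is in the span of the `ψ^*` by Deligne I Prop. 3.4 with Riemann's theorem
(Deligne–Milne II Thm. 6.20), the tree's `Deligne1982.mem_span_complexBetti_map_of_commute_hodgeGroup`.
(Milne: from Mumford p. 208, `e_{D'} = e_D ∘ (α × 1)`, and the dual abelian variety — not the road here.)
[cite: Milne1999LefschetzClasses, §1 p. 642] [cite: MumfordAV1970, §20 p. 189 and p. 208]
[cite: Deligne1982HodgeCycles, I §3 Prop. 3.4] [cite: DeligneMilne1982Tannakian, II Thm. 6.20] -/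
theorem adjoint_pullbackOne_mem_span_pullbackOne (φ : A ⟶ A) {J' : Module.End ℂ (complexBetti A.X 1)}
    (hadj : ∀ x y : complexBetti A.X 1,
      polarizationPairingOne A.X h (A.dim - 1) (pullbackOne A φ x) y =
        polarizationPairingOne A.X h (A.dim - 1) x (J' y)) :
    J' ∈ Submodule.span ℂ (Set.range fun ψ : A ⟶ A ↦ pullbackOne A ψ) :=
  Deligne1982.mem_span_complexBetti_map_of_commute_hodgeGroup A J'
    (adjoint_pullbackOne_commute_hodgeGroup hQ hs hK φ hadj)

/-- **The adjoint of `φ^*` commutes with `C(A) ⊗ ℂ`** (it lies in `End⁰(A) ⊗ ℂ ⊆` the centralizer of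
`C(A)`, Remark 1.2; `pullbackOne_mem_centralizer_centralizerAlgebra`): the form in which
`Milne1999/SpecialLefschetzGroupInvariantsSingleGenerator` takes its datum `J'`.
[cite: Milne1999LefschetzClasses, §1 p. 642 and Remark 1.2 (p. 643)] -/
theorem adjoint_pullbackOne_mem_centralizer_centralizerAlgebra (φ : A ⟶ A)
    {J' : Module.End ℂ (complexBetti A.X 1)}
    (hadj : ∀ x y : complexBetti A.X 1,
      polarizationPairingOne A.X h (A.dim - 1) (pullbackOne A φ x) y =
        polarizationPairingOne A.X h (A.dim - 1) x (J' y)) :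
    J' ∈ Subalgebra.centralizer ℂ (centralizerAlgebra A : Set (Module.End ℂ (complexBetti A.X 1))) := by
  have hJ := adjoint_pullbackOne_mem_span_pullbackOne hQ hs hK φ hadj
  refine (Submodule.span_le (p := Subalgebra.toSubmodule (Subalgebra.centralizer ℂ
    (centralizerAlgebra A : Set (Module.End ℂ (complexBetti A.X 1)))))).2 ?_ hJ
  rintro _ ⟨ψ, rfl⟩
  exact pullbackOne_mem_centralizer_centralizerAlgebra ψ

/-- **The Rosati datum exists**: for every `φ ∈ End(A)` and every rational class `h` with a Kähler
multiple there is an operator `J'` commuting with `C(A) ⊗ ℂ` with `Q_h(φ^*x, y) = Q_h(x, J'y)` — the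
hypothesis `(J', hJ', hJQ)` of `specialLefschetzGroup_invariants_le_of_adjoint`, discharged.
[cite: Milne1999LefschetzClasses, §1 pp. 642–643] [cite: LangeBirkenhake1992, §5.1] -/
theorem exists_adjoint_pullbackOne_mem_centralizer_centralizerAlgebra (φ : A ⟶ A) :
    ∃ J' ∈ Subalgebra.centralizer ℂ (centralizerAlgebra A : Set (Module.End ℂ (complexBetti A.X 1))),
      ∀ x y : complexBetti A.X 1,
        polarizationPairingOne A.X h (A.dim - 1) (pullbackOne A φ x) y =
          polarizationPairingOne A.X h (A.dim - 1) x (J' y) := by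
  obtain ⟨J', hJ'⟩ := exists_adjoint_polarizationPairingOne
    (eq_zero_of_forall_polarizationPairingOne_eq_zero_of_isKaehlerClass_smul' hs hK) (pullbackOne A φ)
  exact ⟨J', adjoint_pullbackOne_mem_centralizer_centralizerAlgebra hQ hs hK φ hJ', hJ'⟩

/-- **«`C(A)` is stable under the involution `†`»** (Milne §1 p. 643): if `S ∈ C(A) ⊗ ℂ` and `S'` is its
`Q_h`-adjoint, then `S' ∈ C(A) ⊗ ℂ`. Indeed for `ψ ∈ End(A)` with adjoint `ψ' ∈ End⁰(A) ⊗ ℂ`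
(`adjoint_pullbackOne_mem_span_pullbackOne`), `S` commutes with `ψ'` (`C(A) ⊗ ℂ` centralises the span of
the pull-backs, `centralizerAlgebra_eq_centralizer_span`), and taking adjoints of `S ψ' = ψ' S` gives
`ψ^* S' = S' ψ^*`. [cite: Milne1999LefschetzClasses, §1 p. 643] -/
theorem adjoint_mem_centralizerAlgebra {S S' : Module.End ℂ (complexBetti A.X 1)}
    (hS : S ∈ centralizerAlgebra A)
    (hadj : ∀ x y : complexBetti A.X 1,
      polarizationPairingOne A.X h (A.dim - 1) (S x) y = polarizationPairingOne A.X h (A.dim - 1) x (S' y)) :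
    S' ∈ centralizerAlgebra A := by
  have hnd := eq_zero_of_forall_polarizationPairingOne_eq_zero_of_isKaehlerClass_smul' hs hK
  rw [mem_centralizerAlgebra_iff']
  intro ψ x
  obtain ⟨ψ', hψ'⟩ := exists_adjoint_polarizationPairingOne hnd (pullbackOne A ψ)
  have hψ'mem := adjoint_pullbackOne_mem_span_pullbackOne hQ hs hK ψ hψ'
  -- `S` commutes with `ψ'`
  have hSψ' : ψ' * S = S * ψ' := by
    have hS' : S ∈ Subalgebra.centralizer ℂ
        (Submodule.span ℂ (Set.range fun φ : A ⟶ A ↦ pullbackOne A φ) :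
          Set (Module.End ℂ (complexBetti A.X 1))) := by
      rw [← centralizerAlgebra_eq_centralizer_span]; exact hS
    exact (Subalgebra.mem_centralizer_iff ℂ).1 hS' ψ' hψ'mem
  -- compare `Q_h(z, S'ψ^*x)` and `Q_h(z, ψ^*S'x)` for all `z`
  rw [← sub_eq_zero]
  refine eq_zero_of_forall_polarizationPairingOne_eq_zero_right hnd _ fun z => ?_
  rw [map_sub, sub_eq_zero, ← hadj, polarizationPairingOne_apply_right_eq_of_adjoint hψ',
    polarizationPairingOne_apply_right_eq_of_adjoint hψ', ← Module.End.mul_apply, hSψ',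
    Module.End.mul_apply, hadj]

end Adjoint

/-! ### §2 Theorem 3.2 / Corollary 4.5 for one diagonalisable generator, unconditionally -/

section Main

variable {A : AbelianVariety ℂ}

/-- **Milne 1999, Prop. 3.6 (a), (c) glued (p. 656), the `S(A)(ℂ)`-invariant form, with the Rosati datum
discharged**: for `φ ∈ End(A)` with `φ^*` diagonalisable on `H¹(A(ℂ); ℂ)` and `C(A) ⊗ ℂ` the commutant of
`φ^*`, and ANY polarization class `h` (rational, with a Kähler multiple `s · h`, `s > 0`), every class
`x ∈ H^{2p}(A(ℂ); ℂ)` fixed by `⋀^{2p}u` for all `u ∈ S(A)(ℂ) = unitaryCentralizerGroup A h` lies in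
`Dᵖ(A) ⊗ ℂ = divisorClassesSpan A.X (dim A) p`
(`mem_divisorClassesSpan_of_forall_exteriorPullback_eq_of_adjoint` with
`exists_adjoint_pullbackOne_mem_centralizer_centralizerAlgebra`).
[cite: Milne1999LefschetzClasses, §1 p. 642, §2 pp. 645–650, Thm. 3.2, Prop. 3.6 (a), (c), p. 656] -/
theorem mem_divisorClassesSpan_of_forall_exteriorPullback_eq_of_generator (φ : A ⟶ A)
    (hC : centralizerAlgebra A = Subalgebra.centralizer ℂ {pullbackOne A φ})
    (hdiag : ⨆ μ : ℂ, Module.End.eigenspace (pullbackOne A φ) μ = ⊤)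
    {h : complexBetti A.X 2} (hQ : IsRationalClass h)
    (hK : ∃ s : ℝ, 0 < s ∧ IsKaehlerClass A.dim A.X ((s : ℂ) • h))
    (p : ℕ) (x : complexBetti A.X (2 * p))
    (hx : ∀ u ∈ unitaryCentralizerGroup A h,
      exteriorPullback (AbelianVariety.hasExteriorCohomologyH1_complexPoints A)
        (u : complexBetti A.X 1 →ₗ[ℂ] complexBetti A.X 1) (2 * p) x = x) :
    x ∈ divisorClassesSpan A.X A.dim p := by
  obtain ⟨s, hs, hKs⟩ := hK
  obtain ⟨J', hJ', hJQ⟩ := exists_adjoint_pullbackOne_mem_centralizer_centralizerAlgebra hQ hs.ne' hKs φ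
  exact mem_divisorClassesSpan_of_forall_exteriorPullback_eq_of_adjoint φ hC hdiag hQ ⟨s, hs, hKs⟩ J' hJ'
    hJQ p x hx

/-- **The conclusion of the record `Milne1999_specialLefschetzGroup_invariants_le` (Milne 1999, Cor. 4.5
with Thm. 4.4 and Thm. 3.2) PROVED for one diagonalisable generator, with no further datum**: for a
complex abelian variety `A` with `φ ∈ End(A)` such that `φ^*` is diagonalisable on `H¹(A(ℂ); ℂ)` and
`C(A) ⊗ ℂ` is the commutant of `φ^*` (e.g. `A` simple of type I with `End⁰(A) = ℚ(φ)` totally real, or of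
type IV with `End⁰(A) = ℚ(φ)` a CM field; Milne §2), every class `x ∈ H^{2p}(A(ℂ); ℂ)` fixed by every
element of `specialLefschetzGroup (dim A) A.X` lies in `Dᵖ_hom(A)_ℂ = divisorClassesSpan A.X (dim A) p`.
The polarization class is the rational Kähler class of a projective embedding
(`nonempty_kaehlerRationalDatum`), its Rosati datum is `exists_adjoint_pullbackOne_mem_centralizer_centralizerAlgebra`.
[cite: Milne1999LefschetzClasses, §1 p. 642, §2 pp. 645–650, Cor. 4.5 and p. 659, Thm. 3.2, Prop. 3.6 (a), (c), p. 656]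
[cite: VoisinHodgeI2002, Thm. 6.25 and §7.1.2] -/
theorem specialLefschetzGroup_invariants_le_of_generator (φ : A ⟶ A)
    (hC : centralizerAlgebra A = Subalgebra.centralizer ℂ {pullbackOne A φ})
    (hdiag : ⨆ μ : ℂ, Module.End.eigenspace (pullbackOne A φ) μ = ⊤)
    (p : ℕ) (x : complexBetti A.X (2 * p)) (hx : ∀ g ∈ specialLefschetzGroup A.dim A.X, g (2 * p) x = x) :
    x ∈ divisorClassesSpan A.X A.dim p := by
  -- the rational Kähler class of a projective embedding
  obtain ⟨D⟩ := nonempty_kaehlerRationalDatum (AbelianVariety.isSmoothProjective_holds (A := A))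
  have hQ : IsRationalClass D.Hη := D.isRationalClass_Hη
  have hK1 : IsKaehlerClass A.dim A.X (((1 : ℝ) : ℂ) • D.Hη) := by
    rw [Complex.ofReal_one, one_smul]
    exact D.isKaehlerClassVia.isKaehlerClass D.isNatural D.isMultiplicative
  obtain ⟨J', hJ', hJQ⟩ := exists_adjoint_pullbackOne_mem_centralizer_centralizerAlgebra hQ one_ne_zero hK1 φ
  exact specialLefschetzGroup_invariants_le_of_adjoint φ hC hdiag hQ ⟨1, one_pos, hK1⟩ J' hJ' hJQ p x hx

/-- **Cor. 4.5 as an equality of sets, for one diagonalisable generator**: the `S(A)`-invariants of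
`H^{2p}(A(ℂ); ℂ)` are EXACTLY `Dᵖ_hom(A)_ℂ` (the converse inclusion is definitional,
`apply_eq_self_of_mem_specialLefschetzGroup`). [cite: Milne1999LefschetzClasses, Cor. 4.5 (p. 659)] -/
theorem setOf_forall_apply_eq_self_eq_divisorClassesSpan_of_generator (φ : A ⟶ A)
    (hC : centralizerAlgebra A = Subalgebra.centralizer ℂ {pullbackOne A φ})
    (hdiag : ⨆ μ : ℂ, Module.End.eigenspace (pullbackOne A φ) μ = ⊤) (p : ℕ) :
    {x : complexBetti A.X (2 * p) | ∀ g ∈ specialLefschetzGroup A.dim A.X, g (2 * p) x = x} =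
      (divisorClassesSpan A.X A.dim p : Set _) :=
  Set.Subset.antisymm (fun x hx => specialLefschetzGroup_invariants_le_of_generator φ hC hdiag p x hx)
    fun _ hx _ hg => apply_eq_self_of_mem_specialLefschetzGroup hg hx

/-- **Milne Prop. 4.8, (c) ⇒ (a) on `A` itself, for one diagonalisable generator**: if `Hg′(A) = S(A)`
then every rational `(p,p)`-class of `A` is fixed by `S(A)`, hence lies in `Dᵖ ⊗ ℂ` —
`IsDivisorGenerated A`. [cite: Milne1999LefschetzClasses, Prop. 4.8 and Cor. 4.5 (pp. 659–660)] -/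
theorem isDivisorGenerated_of_hodgeGroup_eq_specialLefschetzGroup_of_generator (φ : A ⟶ A)
    (hC : centralizerAlgebra A = Subalgebra.centralizer ℂ {pullbackOne A φ})
    (hdiag : ⨆ μ : ℂ, Module.End.eigenspace (pullbackOne A φ) μ = ⊤)
    (hHg : hodgeGroup A.dim A.X = specialLefschetzGroup A.dim A.X) : IsDivisorGenerated A :=
  fun p c hc hpp => specialLefschetzGroup_invariants_le_of_generator φ hC hdiag p c
    fun _ hg => apply_eq_self_of_mem_hodgeGroup (hHg ▸ hg) hc hpp

end Main

/-! ### §3 The same with `End(A)` acting through polynomials in one diagonalisable `φ^*` -/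

section Adjoin

variable {A : AbelianVariety ℂ}

/-- **If every `ψ^*`, `ψ ∈ End(A)`, is a polynomial in `φ^*`, then `C(A) ⊗ ℂ` is the commutant of `φ^*`
alone** (`C(A) = End_{End⁰(A) ⊗ k}(V(A))`, §1 p. 642: centralising a generating set is centralising the
algebra; Mathlib's `Algebra.adjoin_le_centralizer_centralizer`). E.g. `End⁰(A) = ℚ(φ)` a field (simple
types I and IV with `d = 1`). [cite: Milne1999LefschetzClasses, §1 p. 642 and §2 pp. 645–650] -/
theorem centralizerAlgebra_eq_centralizer_singleton_of_forall_mem_adjoin (φ : A ⟶ A)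
    (hgen : ∀ ψ : A ⟶ A, pullbackOne A ψ ∈ Algebra.adjoin ℂ {pullbackOne A φ}) :
    centralizerAlgebra A = Subalgebra.centralizer ℂ {pullbackOne A φ} := by
  refine le_antisymm (Subalgebra.centralizer_le ℂ _ _ (Set.singleton_subset_iff.2 ⟨φ, rfl⟩)) ?_
  intro T hT
  rw [mem_centralizerAlgebra_iff]
  intro ψ
  have hψ := Algebra.adjoin_le_centralizer_centralizer ℂ _ (hgen ψ)
  exact ((Subalgebra.mem_centralizer_iff ℂ).1 hψ T hT).symm

/-- **Milne 1999, Cor. 4.5 / Thm. 3.2 for `End(A)` acting on `H¹(A(ℂ); ℂ)` through polynomials in one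
diagonalisable `φ^*`** (no polarization or adjoint datum): every class of `H^{2p}(A(ℂ); ℂ)` fixed by
`specialLefschetzGroup (dim A) A.X` lies in `Dᵖ_hom(A)_ℂ`.
[cite: Milne1999LefschetzClasses, §1 p. 642, §2 pp. 645–650, Thm. 3.2, Cor. 4.5 (p. 659)] -/
theorem specialLefschetzGroup_invariants_le_of_forall_mem_adjoin (φ : A ⟶ A)
    (hgen : ∀ ψ : A ⟶ A, pullbackOne A ψ ∈ Algebra.adjoin ℂ {pullbackOne A φ})
    (hdiag : ⨆ μ : ℂ, Module.End.eigenspace (pullbackOne A φ) μ = ⊤)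
    (p : ℕ) (x : complexBetti A.X (2 * p)) (hx : ∀ g ∈ specialLefschetzGroup A.dim A.X, g (2 * p) x = x) :
    x ∈ divisorClassesSpan A.X A.dim p :=
  specialLefschetzGroup_invariants_le_of_generator φ
    (centralizerAlgebra_eq_centralizer_singleton_of_forall_mem_adjoin φ hgen) hdiag p x hx

/-- **Cor. 4.5 as an equality of sets**, same hypotheses. [cite: Milne1999LefschetzClasses, Cor. 4.5 (p. 659)] -/
theorem setOf_forall_apply_eq_self_eq_divisorClassesSpan_of_forall_mem_adjoin (φ : A ⟶ A)
    (hgen : ∀ ψ : A ⟶ A, pullbackOne A ψ ∈ Algebra.adjoin ℂ {pullbackOne A φ})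
    (hdiag : ⨆ μ : ℂ, Module.End.eigenspace (pullbackOne A φ) μ = ⊤) (p : ℕ) :
    {x : complexBetti A.X (2 * p) | ∀ g ∈ specialLefschetzGroup A.dim A.X, g (2 * p) x = x} =
      (divisorClassesSpan A.X A.dim p : Set _) :=
  setOf_forall_apply_eq_self_eq_divisorClassesSpan_of_generator φ
    (centralizerAlgebra_eq_centralizer_singleton_of_forall_mem_adjoin φ hgen) hdiag p

/-- **Milne Prop. 4.8, (c) ⇒ (a)**, same hypotheses. [cite: Milne1999LefschetzClasses, Prop. 4.8 and Cor. 4.5 (pp. 659–660)] -/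
theorem isDivisorGenerated_of_hodgeGroup_eq_specialLefschetzGroup_of_forall_mem_adjoin (φ : A ⟶ A)
    (hgen : ∀ ψ : A ⟶ A, pullbackOne A ψ ∈ Algebra.adjoin ℂ {pullbackOne A φ})
    (hdiag : ⨆ μ : ℂ, Module.End.eigenspace (pullbackOne A φ) μ = ⊤)
    (hHg : hodgeGroup A.dim A.X = specialLefschetzGroup A.dim A.X) : IsDivisorGenerated A :=
  isDivisorGenerated_of_hodgeGroup_eq_specialLefschetzGroup_of_generator φ
    (centralizerAlgebra_eq_centralizer_singleton_of_forall_mem_adjoin φ hgen) hdiag hHg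

end Adjoin

end Literature.AlgebraicGeometry.Milne1999

end
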